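/-
Copyright (c) 2026 the pub-hodgecm-mathlib formalisation cell (harness21).  Prover seat hodgecm-mathlib-F0P3-p01 (g18), 2026-09-01.  Road «S3-ram» seeding wave (LEAD F0P3a-plan (g12);
owner F0P3a-p06 (g15)), row «(L)-ram» ∕ (U)-ram two-layer head (R4): the RANK-1 LABEL of the depth-1 interior stratum READ THROUGH AN INTEGRAL FRAME — the frame scalar washes out.
-/
import Literature.NumberTheory.Automorphic.TorusTwoDeepLevelTwoStrata    -- ★ p846625: §1 `GL₃(𝒪_w)`-conjugation kit for `redMat` (`conj_pow_three_eq_zero_iff_aux`, `redMat_coe_inv_mul_redMat_coe`), CM local carriers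
import Literature.LinearAlgebra.Matrix.RankOneMatrices                 -- ★ `rank_vecMulVec_eq_one`
import HarnessLib

/-!
# The rank-1 label of the depth-1 interior stratum through an integral frame (Rogawski (1990) §4.9; Kottwitz (1986) §3)

Topic `NumberTheory/Automorphic`; namespace `Literature.NumberTheory.Automorphic.UnitaryGroup`.  KERNEL MATHEMATICS ONLY: theorems, no definition, no named fact, no
instance, no notation, no `sorry`.  Cell `pub/hodgecm-mathlib`, crux H413 = `stmt-HodgeConjecture-24833`; road «S3-ram» seeding wave (LEAD F0P3a-plan (g12), owner∕table
F0P3a-p06 (g15)); organ «RANK-1 LABEL THROUGH A FRAME» (seat F0P3-p01 (g18)) serving the SPLIT edition (L5 ∕ ED. 2) of the `N ∩ K₃`-column `hN` of the ramified Levi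
row (★ `DepthZeroKappaTransferLeviRamifiedLevelOne`, ★ `…OfFrame` §2; N-column files L1–L4 of F0P3-p02 (g16)) and the two-layer (U)-ram head of F0P2-p01 (g15)
(`exists_twoLayerStrataValues_of_levelOne_ramified`, row (R4)).  HONEST LABEL: HC_CM is proved only modulo the cell's printed citations until rung 0 closes; «S3-ram»
is Literature seeding with no books consequence; this file discharges nothing by itself.

THE MATHEMATICS.  A `v`-level-one `K`-class piece `g` at a tame-ramified non-split place takes, on the depth-1 interior stratum of residual rank `1`
(`N(x) := red(ϖ⁻¹(x_w − 1))` a rank-1 nilpotent, self-adjoint for `J̄ = red(H′_w)`), a value `c₁(t)` indexed by the VALUE `t = z ⬝ᵥ (J̄ N(x)) z ≠ 0` of the residual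
quadratic form at ANY vector `z` where it is non-zero (row (R4) of the two-layer head; only the square class of `t` matters, row (R5), but that is not used here).
Read through an integral frame `(ψ x)_w = T x_w T⁻¹`, `T ∈ GL₃(𝒪_w)`, a point `n` of the rank-1 interior stratum of `N ∩ K₃` in the standard model has
`N(n) = β·E₀₂` (`β = red(ϖ⁻¹ z_w) ≠ 0`) and `N(ψ⁻¹ n) = T̄⁻¹(β·E₀₂)T̄`, so the (R4) value at a vector `z` is `β · ℓ₁(z) · ℓ₂(z)` with the two NON-ZERO linear forms
`ℓ₁(z) = (z ᵥ* (J̄T̄⁻¹))₀`, `ℓ₂(z) = (T̄ z)₂`.  Choosing ONE `z₀` off both kernels (always possible: `e_i`, `e_j` or `e_i + e_j`) gives a scalar `λ_T := ℓ₁(z₀)ℓ₂(z₀) ≠ 0`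
depending on `(T̄, J̄)` only, with `g(ψ⁻¹ n) = c₁(λ_T · β)` for EVERY `β ≠ 0` — no relation between `T` and the hermitian form, no self-adjointness and no square-class
bookkeeping is needed, and `λ_T` disappears from `Σ_{β ∈ 𝓀ˣ} c₁(λ_T β) = Σ_{t ∈ 𝓀ˣ} c₁(t)` (`finsum_ite_eq_zero_comp_mul_left`).  Consequence for the N-column: the
ALL-FRAMES socket `hN` of ★ `…LeviRamifiedLevelOne` ∕ ★ `…OfFrame` §2 (frames bound by `hψK hψc hT hψT` only) stays dischargeable for the FULL `v`-level-1 piece class,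
with the rank-1 interior term `q⁻³·Σ_{t ∈ 𝓀ˣ} c₁ t` (each residue fibre of the stratum has mass `q⁻³·μ_N(N ∩ K₃)`).
* §1 `exists_dotProduct_ne_zero_and_dotProduct_ne_zero`, `dotProduct_mulVec_mul_conj_corner`, `exists_ne_zero_exists_forall_dotProduct_mulVec_conj_corner_eq_mul` — pure
  linear algebra over a field; `finsum_ite_eq_zero_comp_mul_left` — the reindexing `β ↦ λβ` of `Σ_{𝓀ˣ}`.
* §2 `exists_ne_zero_forall_apply_eq_of_rankOne_label` — the (R4) row read through `T ∈ GL₃(𝒪_w)`: `∃ λ ≠ 0, ∀ x β, … N(x) = T̄⁻¹(β·E₀₂)T̄ … → g x = c₁(λβ)` (place-generic;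
  binders `hH′w hH′i` of END's `stub_levelOneRowsRam` and the (R4) text of F0P2-p01 (g15) VERBATIM).

## References
* [Rogawski1990] J. D. Rogawski, *Automorphic Representations of Unitary Groups in Three Variables*, Ann. of Math. Stud. 123 (1990), §4.9 pp. 54–56 (the `K`-class pieces
  and their strata); §3.9 p. 32.
* [Kottwitz1986] R. E. Kottwitz, *Base change for unit elements of Hecke algebras*, Compositio Math. 60 (1986), §3 (congruence filtration, reduction of integral frames).
* [HornJohnson2013] R. A. Horn, C. R. Johnson, *Matrix Analysis*, 2nd ed. (2013), §0.4.6 (rank-one matrices, rank under equivalence).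
-/

set_option autoImplicit false

noncomputable section

open NumberField IsDedekindDomain Matrix ValuativeRel
open scoped Matrix MatrixGroups ValuativeRel

namespace Literature.NumberTheory.Automorphic.UnitaryGroup

open Literature.NumberTheory.Automorphic Literature.NumberTheory.Automorphic.IntegralReduction Literature.NumberTheory.GaloisRepresentations

/-! ## §1 Pure linear algebra: a vector off two hyperplanes, the corner conjugate, the reindexing -/

section Field

variable {k : Type*} [Field k]

/-- **A vector off two coordinate-hyperplane complements**: for non-zero `a, b : n → k` there is `z` with `z ⬝ᵥ a ≠ 0` and `b ⬝ᵥ z ≠ 0` (`z = e_i`, `e_j` or `e_i + e_j`;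
no hypothesis on the size of `k`). [cite: HornJohnson2013, §0.4.6] -/
theorem exists_dotProduct_ne_zero_and_dotProduct_ne_zero {n : Type*} [Fintype n] [DecidableEq n] {a b : n → k} (ha : a ≠ 0) (hb : b ≠ 0) :
    ∃ z : n → k, z ⬝ᵥ a ≠ 0 ∧ b ⬝ᵥ z ≠ 0 := by
  obtain ⟨i, hi⟩ := Function.ne_iff.1 ha
  obtain ⟨j, hj⟩ := Function.ne_iff.1 hb
  have h1a : (Pi.single i 1 : n → k) ⬝ᵥ a = a i := by rw [single_dotProduct, one_mul]
  have h2b : b ⬝ᵥ (Pi.single j 1 : n → k) = b j := by rw [dotProduct_single, mul_one]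
  by_cases h1 : b ⬝ᵥ (Pi.single i 1 : n → k) = 0
  · by_cases h2 : (Pi.single j 1 : n → k) ⬝ᵥ a = 0
    · refine ⟨Pi.single i 1 + Pi.single j 1, ?_, ?_⟩
      · rw [add_dotProduct, h2, add_zero, h1a]; exact hi
      · rw [dotProduct_add, h1, zero_add, h2b]; exact hj
    · exact ⟨Pi.single j 1, h2, by rw [h2b]; exact hj⟩
  · exact ⟨Pi.single i 1, by rw [h1a]; exact hi, h1⟩

/-- **The corner conjugate read by a quadratic form**: `z ⬝ᵥ (J (Q (β·E₀₂) P) z) = β · (z ᵥ* (J Q))₀ · (P z)₂` (`Q E₀₂ P` is the rank-one matrix `(Q e₀)(P-row₂)ᵀ`).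
[cite: HornJohnson2013, §0.4.6] -/
theorem dotProduct_mulVec_mul_conj_corner (J P Q : Matrix (Fin 3) (Fin 3) k) (β : k) (z : Fin 3 → k) :
    z ⬝ᵥ ((J * (Q * !![0, 0, β; 0, 0, 0; 0, 0, 0] * P)) *ᵥ z) = β * ((z ᵥ* (J * Q)) 0 * (P *ᵥ z) 2) := by
  have hE : Q * !![0, 0, β; 0, 0, 0; 0, 0, 0] * P = β • vecMulVec (fun i => Q i 0) (fun j => P 2 j) := by
    ext i j
    simp [Matrix.mul_apply, Fin.sum_univ_three, vecMulVec_apply]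
    ring
  rw [hE, Matrix.mul_smul, Matrix.smul_mulVec, dotProduct_smul, smul_eq_mul]
  congr 1
  simp only [dotProduct, mulVec, vecMul, Matrix.mul_apply, vecMulVec_apply, Fin.sum_univ_three]
  ring

/-- **THE FRAME SCALAR**: for `J` with `det J ≠ 0` and `Q P = 1` there are `λ ≠ 0` and ONE vector `z` with `z ⬝ᵥ (J (Q (β·E₀₂) P) z) = λ·β` for EVERY `β`
(`λ = (z ᵥ* (JQ))₀ · (Pz)₂`, both factors non-zero: column `0` of `JQ` and row `2` of `P` are non-zero). [cite: HornJohnson2013, §0.4.6] [cite: Rogawski1990, §4.9 pp. 54–56] -/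
theorem exists_ne_zero_exists_forall_dotProduct_mulVec_conj_corner_eq_mul (J P Q : Matrix (Fin 3) (Fin 3) k) (hJ : J.det ≠ 0) (hQP : Q * P = 1) :
    ∃ lam : k, lam ≠ 0 ∧ ∃ z : Fin 3 → k, ∀ β : k, z ⬝ᵥ ((J * (Q * !![0, 0, β; 0, 0, 0; 0, 0, 0] * P)) *ᵥ z) = lam * β := by
  have hPQ : P.det * Q.det = 1 := by rw [mul_comm, ← det_mul, hQP, det_one]
  have hP : P.det ≠ 0 := left_ne_zero_of_mul_eq_one hPQ
  have hQ : Q.det ≠ 0 := right_ne_zero_of_mul_eq_one hPQ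
  have ha : (fun i => (J * Q) i 0) ≠ 0 := fun h => by
    have h0 : (J * Q).det = 0 := det_eq_zero_of_column_eq_zero 0 fun i => congrFun h i
    rw [det_mul] at h0
    exact mul_ne_zero hJ hQ h0
  have hb : (fun j => P 2 j) ≠ 0 := fun h => hP (det_eq_zero_of_row_eq_zero 2 fun j => congrFun h j)
  obtain ⟨z, hz1, hz2⟩ := exists_dotProduct_ne_zero_and_dotProduct_ne_zero ha hb
  refine ⟨(z ᵥ* (J * Q)) 0 * (P *ᵥ z) 2, mul_ne_zero hz1 hz2, z, fun β => ?_⟩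
  rw [dotProduct_mulVec_mul_conj_corner, mul_comm]

open scoped Classical in
/-- **The frame scalar washes out of `Σ_{𝓀ˣ}`**: `Σ_{β ≠ 0} c(λβ) = Σ_{t ≠ 0} c(t)` for `λ ≠ 0` (reindexing by the bijection `β ↦ λβ`; the rank-1 interior term of the
`N ∩ K₃`-column). [cite: Rogawski1990, §4.9 pp. 54–56] -/
theorem finsum_ite_eq_zero_comp_mul_left {M : Type*} [AddCommMonoid M] (c : k → M) {lam : k} (hlam : lam ≠ 0) :
    ∑ᶠ β : k, (if β = 0 then 0 else c (lam * β)) = ∑ᶠ t : k, (if t = 0 then 0 else c t) := by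
  refine finsum_eq_of_bijective (fun β => lam * β) (mulLeft_bijective₀ lam hlam) fun β => ?_
  by_cases hβ : β = 0
  · rw [if_pos hβ, if_pos (by rw [hβ, mul_zero])]
  · rw [if_neg hβ, if_neg (mul_ne_zero hlam hβ)]

end Field

/-! ## §2 The (R4) row read through an integral frame: `g x = c₁(λ_T · β)` whenever `N(x) = T̄⁻¹(β·E₀₂)T̄`, `β ≠ 0` -/

variable (L : Type) [Field L] [NumberField L] [IsCMField L] {v : HeightOneSpectrum (𝓞 ↥(maximalRealSubfield L))}
  (w : PlacesOver L v)

omit [IsCMField L] in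
/-- `det(red H′_w) ≠ 0` for a place form that is a unit with integral unit (END's `hH′w hH′i`). [cite: Kottwitz1986, §3] -/
theorem det_redMat_placeForm_ne_zero (H' : Matrix (Fin 3) (Fin 3) L) (hH'w : IsUnit (placeForm H' w.1)) (hH'i : hH'w.unit ∈ glInt 3 (w.1.adicCompletion L)) :
    (redMat (placeForm H' w.1)).det ≠ 0 := by
  have h1 := redMat_coe_mul_redMat_coe_inv hH'i
  rw [IsUnit.unit_spec] at h1
  intro h0
  have h := congrArg Matrix.det h1
  rw [det_mul, h0, zero_mul, det_one] at h
  exact zero_ne_one h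

set_option maxHeartbeats 800000 in
-- the (R4) hypothesis text is large; elaboration of its instantiation is slow but routine
/-- **THE (R4) ROW THROUGH AN INTEGRAL FRAME — THE FRAME SCALAR.**  `g` a piece with the rank-1 interior row (R4) of the two-layer (U)-ram head (F0P2-p01 (g15)
`exists_twoLayerStrataValues_of_levelOne_ramified`, text VERBATIM: the value on `x ∈ K′`, `x_w ≡ 1 (ϖ)`, `N(x)³ = 0`, `rank N(x) = 1` is `c₁(z ⬝ᵥ (J̄ N(x)) z)` for ANY `z` with
non-zero value, `N(x) = red(ϖ⁻¹(x_w − 1))`, `J̄ = red(H′_w)`), `T ∈ GL₃(𝒪_w)`.  Then there is `λ ≠ 0` (depending on `T̄`, `J̄` only) such that **`g x = c₁(λ·β)` for every such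
`x` with `N(x) = T̄⁻¹(β·E₀₂)T̄`, `β ≠ 0`** — the shape of `N(ψ⁻¹ n)` (`(ψ x)_w = T x_w T⁻¹`) for `n` on the rank-1 interior stratum of `N ∩ K₃`, `β = red(ϖ⁻¹ z_w)`.
Place-generic (no ramification hypothesis); (R5) not used. [cite: Rogawski1990, §4.9 pp. 54–56; §3.9 p. 32] [cite: Kottwitz1986, §3] -/
theorem exists_ne_zero_forall_apply_eq_of_rankOne_label (H' : Matrix (Fin 3) (Fin 3) L)
    (hH'w : IsUnit (placeForm H' w.1)) (hH'i : hH'w.unit ∈ glInt 3 (w.1.adicCompletion L))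
    (ϖ : w.1.adicCompletion L) (g : ((cmDatum L 3 H').Local v) → ℂ) (c₁ : 𝓀[(w.1.adicCompletion L)] → ℂ)
    -- row (R4) of the two-layer (U)-ram head, VERBATIM
    (hR4 : ∀ (x : ((cmDatum L 3 H').Local v)) (z : Fin 3 → 𝓀[(w.1.adicCompletion L)]), (x ∈ cmLocalIntegralLevel L 3 H' v ∧
        (∀ a b, Valued.v (ϖ⁻¹ * ((((x).val : GL (Fin 3) (UnitaryGroup.LocalRing L v)).val.map (Pi.evalRingHom (fun w' : PlacesOver L v => w'.1.adicCompletion L) w)) a b - (1 : Matrix (Fin 3) (Fin 3) (w.1.adicCompletion L)) a b)) ≤ 1) ∧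
        (redMat (ϖ⁻¹ • ((((x).val : GL (Fin 3) (UnitaryGroup.LocalRing L v)).val.map (Pi.evalRingHom (fun w' : PlacesOver L v => w'.1.adicCompletion L) w)) - 1))) ^ 3 = 0 ∧ (redMat (ϖ⁻¹ • ((((x).val : GL (Fin 3) (UnitaryGroup.LocalRing L v)).val.map (Pi.evalRingHom (fun w' : PlacesOver L v => w'.1.adicCompletion L) w)) - 1))).rank = 1 ∧
        z ⬝ᵥ ((redMat (placeForm H' w.1) * redMat (ϖ⁻¹ • ((((x).val : GL (Fin 3) (UnitaryGroup.LocalRing L v)).val.map (Pi.evalRingHom (fun w' : PlacesOver L v => w'.1.adicCompletion L) w)) - 1))) *ᵥ z) ≠ 0) →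
        g x = c₁ (z ⬝ᵥ ((redMat (placeForm H' w.1) * redMat (ϖ⁻¹ • ((((x).val : GL (Fin 3) (UnitaryGroup.LocalRing L v)).val.map (Pi.evalRingHom (fun w' : PlacesOver L v => w'.1.adicCompletion L) w)) - 1))) *ᵥ z)))
    (T : GL (Fin 3) (w.1.adicCompletion L)) (hT : T ∈ glInt 3 (w.1.adicCompletion L)) :
    ∃ lam : 𝓀[(w.1.adicCompletion L)], lam ≠ 0 ∧ ∀ (x : ((cmDatum L 3 H').Local v)) (β : 𝓀[(w.1.adicCompletion L)]), β ≠ 0 → x ∈ cmLocalIntegralLevel L 3 H' v →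
      (∀ a b, Valued.v (ϖ⁻¹ * ((((x).val : GL (Fin 3) (UnitaryGroup.LocalRing L v)).val.map (Pi.evalRingHom (fun w' : PlacesOver L v => w'.1.adicCompletion L) w)) a b - (1 : Matrix (Fin 3) (Fin 3) (w.1.adicCompletion L)) a b)) ≤ 1) →
      redMat (ϖ⁻¹ • ((((x).val : GL (Fin 3) (UnitaryGroup.LocalRing L v)).val.map (Pi.evalRingHom (fun w' : PlacesOver L v => w'.1.adicCompletion L) w)) - 1)) =
        redMat ((T⁻¹ : GL (Fin 3) (w.1.adicCompletion L)) : Matrix (Fin 3) (Fin 3) (w.1.adicCompletion L)) * !![0, 0, β; 0, 0, 0; 0, 0, 0] * redMat (T : Matrix (Fin 3) (Fin 3) (w.1.adicCompletion L)) →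
      g x = c₁ (lam * β) := by
  have hQP := redMat_coe_inv_mul_redMat_coe hT
  have hPQ := redMat_coe_mul_redMat_coe_inv hT
  obtain ⟨lam, hlam, z, hz⟩ := exists_ne_zero_exists_forall_dotProduct_mulVec_conj_corner_eq_mul (redMat (placeForm H' w.1))
    (redMat (T : Matrix (Fin 3) (Fin 3) (w.1.adicCompletion L))) (redMat ((T⁻¹ : GL (Fin 3) (w.1.adicCompletion L)) : Matrix (Fin 3) (Fin 3) (w.1.adicCompletion L)))
    (det_redMat_placeForm_ne_zero L w H' hH'w hH'i) hQP
  refine ⟨lam, hlam, fun x β hβ hxK hint hN => ?_⟩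
  -- the conjugate of the corner matrix: cube zero, rank one
  have hE3 : (!![0, 0, β; 0, 0, 0; 0, 0, 0] : Matrix (Fin 3) (Fin 3) 𝓀[(w.1.adicCompletion L)]) ^ 3 = 0 := by
    ext i j; fin_cases i <;> fin_cases j <;> simp [pow_three, Matrix.mul_apply, Fin.sum_univ_three]
  have hErank : (!![0, 0, β; 0, 0, 0; 0, 0, 0] : Matrix (Fin 3) (Fin 3) 𝓀[(w.1.adicCompletion L)]).rank = 1 := by
    have hvv : (!![0, 0, β; 0, 0, 0; 0, 0, 0] : Matrix (Fin 3) (Fin 3) 𝓀[(w.1.adicCompletion L)]) = vecMulVec (Pi.single 0 β) (Pi.single 2 1) := by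
      ext i j; fin_cases i <;> fin_cases j <;> simp [vecMulVec_apply]
    rw [hvv]
    refine Literature.LinearAlgebra.Matrix.rank_vecMulVec_eq_one ?_ ?_
    · exact fun h => hβ (by simpa using congrFun h 0)
    · intro h
      have h2 := congrFun h (2 : Fin 3)
      rw [Pi.single_eq_same, Pi.zero_apply] at h2
      exact one_ne_zero h2
  have hdet : IsUnit (redMat (T : Matrix (Fin 3) (Fin 3) (w.1.adicCompletion L))).det :=
    IsUnit.of_mul_eq_one (redMat (((T⁻¹ : GL (Fin 3) (w.1.adicCompletion L))) : Matrix (Fin 3) (Fin 3) (w.1.adicCompletion L))).det (by rw [← Matrix.det_mul, hPQ, Matrix.det_one])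
  have hdet' : IsUnit (redMat (((T⁻¹ : GL (Fin 3) (w.1.adicCompletion L))) : Matrix (Fin 3) (Fin 3) (w.1.adicCompletion L))).det :=
    IsUnit.of_mul_eq_one (redMat (T : Matrix (Fin 3) (Fin 3) (w.1.adicCompletion L))).det (by rw [← Matrix.det_mul, hQP, Matrix.det_one])
  have h3 : (redMat (ϖ⁻¹ • ((((x).val : GL (Fin 3) (UnitaryGroup.LocalRing L v)).val.map (Pi.evalRingHom (fun w' : PlacesOver L v => w'.1.adicCompletion L) w)) - 1))) ^ 3 = 0 := by
    rw [hN, conj_pow_three_eq_zero_iff_aux _ _ _ hPQ]; exact hE3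
  have hr : (redMat (ϖ⁻¹ • ((((x).val : GL (Fin 3) (UnitaryGroup.LocalRing L v)).val.map (Pi.evalRingHom (fun w' : PlacesOver L v => w'.1.adicCompletion L) w)) - 1))).rank = 1 := by
    rw [hN, Matrix.rank_mul_eq_left_of_isUnit_det _ _ hdet, Matrix.rank_mul_eq_right_of_isUnit_det _ _ hdet', hErank]
  have hval : z ⬝ᵥ ((redMat (placeForm H' w.1) * redMat (ϖ⁻¹ • ((((x).val : GL (Fin 3) (UnitaryGroup.LocalRing L v)).val.map (Pi.evalRingHom (fun w' : PlacesOver L v => w'.1.adicCompletion L) w)) - 1))) *ᵥ z) = lam * β := by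
    rw [hN]; exact hz β
  have h := hR4 x z ⟨hxK, hint, h3, hr, by rw [hval]; exact mul_ne_zero hlam hβ⟩
  rwa [hval] at h

end Literature.NumberTheory.Automorphic.UnitaryGroup

end
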